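import Mathlib.Topology.Algebra.Category.ProfiniteGrp.Basic
import Literature.IUT.HodgeTheaters.PuncturedEllipticCoveringsCusps
import Literature.IUT.HodgeTheaters.PuncturedEllipticArrowModelGalois
import HarnessLib

/-!
# The finite model of [IUTchI] §1, part 6: the product `Γ × (N ⋊ D_l)` over an arbitrary profinite `Γ = G_k` (definitions)

Mochizuki, *Inter-universal Teichmüller theory I*, kurims manuscript (May 2020), §1 pp. 37–38, Def. 3.1
(b)(d)(f) pp. 61–63 ([IUTchI] §1 p.37) [claim: Mochizuki2012, status: disputed] (D-0012 claim key; series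
status DISPUTED — WITNESS-class module; nothing of the series is asserted, no side is taken on [IUTchIII]
Cor. 3.12).

To place the §1 model of abc-iut-L5-t1 (parts 1–5: `Φ := N ⋊ D_l`, all §1 claims at `G_k = 1`) inside
abc-iut-L5-t2's `ThetaGeometry G_F G_K l` (whose `pe.E.gal` must be `G_K`, an infinite profinite group), we follow
abc-iut-S2's `ThetaGeometryModel` pattern (`ThetaGeometryInhabited.lean`, there with the abelian factor
`ℤ/2 × ℤ/l`, at which `ArrowCoveringClaims` FAILS — abc-iut-L5-t8 g4's NV-1): replace the factor by `Φ`.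
This file: `Π := Γ × Φ ↠ Γ` for any compact totally disconnected group `Γ` (discrete topology on `Φ`, declared
locally — no instance is registered), the transports `liftSub D = Γ × D` and `botSub D = {1} × D` of subgroups
of `Φ` with their index / lattice / closure identities, and the datum `pedOf Γ l` : `Π_X := Γ × Φ_X`,
`Π_C̲ := Γ × Φ_C̲`, decomposition groups `Γ × D_i` (they surject onto `Γ = G_k`: rational cusps), cusps `ℤ/l`,
`ε⁰, ε′, ε″, 2ε := 0, 1, −1, 2`.  The §1 claims for `pedOf` and the `ThetaGeometry` are the sequel
(`PuncturedEllipticArrowModelTheta.lean`).  Universe `0` throughout (`Γ : Type`).  No `sorry`, symbolic `l`.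
-/

namespace Literature.IUT.HodgeTheaters

namespace PuncturedEllipticData

namespace ArrowModel

open Literature.AnabelianGeometry.AbsoluteAnabelian DihedralGroup
open scoped Pointwise

/-! ### Transport of subgroups of `Φ` to `Γ × Φ` -/

section Transport

variable (Γ : Type) [Group Γ] (l : ℕ)

/-- `Γ × D ⊆ Γ × Φ` for a subgroup `D ⊆ Φ`. [claim: Mochizuki2012, status: disputed] -/
def liftSub (D : Subgroup (G l)) : Subgroup (Γ × G l) := D.comap (MonoidHom.snd Γ (G l))

/-- `{1} × D ⊆ Γ × Φ` for a subgroup `D ⊆ Φ` (these live in the geometric part `Δ = {1} × Φ`).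
[claim: Mochizuki2012, status: disputed] -/
def botSub (D : Subgroup (G l)) : Subgroup (Γ × G l) := D.map (MonoidHom.inr Γ (G l))

variable {Γ l}

/-- Membership in `Γ × D`. [claim: Mochizuki2012, status: disputed] -/
@[simp] theorem mem_liftSub {D : Subgroup (G l)} {x : Γ × G l} : x ∈ liftSub Γ l D ↔ x.2 ∈ D := Iff.rfl

/-- Membership in `{1} × D`. [claim: Mochizuki2012, status: disputed] -/
theorem mem_botSub {D : Subgroup (G l)} {x : Γ × G l} : x ∈ botSub Γ l D ↔ x.1 = 1 ∧ x.2 ∈ D := by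
  constructor
  · rintro ⟨d, hd, rfl⟩; exact ⟨rfl, hd⟩
  · rintro ⟨h1, h2⟩; exact ⟨x.2, h2, Prod.ext h1.symm rfl⟩

variable (Γ l)

/-- `[Γ × Φ : Γ × D] = [Φ : D]`. [claim: Mochizuki2012, status: disputed] -/
theorem liftSub_index (D : Subgroup (G l)) : (liftSub Γ l D).index = D.index :=
  Subgroup.index_comap_of_surjective D Prod.snd_surjective

/-- `[Γ × D′ : Γ × D] = [D′ : D]`. [claim: Mochizuki2012, status: disputed] -/
theorem liftSub_relIndex (D D' : Subgroup (G l)) :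
    (liftSub Γ l D).relIndex (liftSub Γ l D') = D.relIndex D' := by
  rw [liftSub, liftSub, Subgroup.relIndex_comap, Subgroup.map_comap_eq_self_of_surjective Prod.snd_surjective]

/-- `[{1} × D′ : {1} × D] = [D′ : D]`. [claim: Mochizuki2012, status: disputed] -/
theorem botSub_relIndex (D D' : Subgroup (G l)) :
    (botSub Γ l D).relIndex (botSub Γ l D') = D.relIndex D' :=
  Subgroup.relIndex_map_map_of_injective D D' fun _ _ h => (Prod.ext_iff.mp h).2

/-- `Γ × (D ∩ D′) = (Γ × D) ∩ (Γ × D′)`. [claim: Mochizuki2012, status: disputed] -/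
theorem liftSub_inf (D D' : Subgroup (G l)) : liftSub Γ l (D ⊓ D') = liftSub Γ l D ⊓ liftSub Γ l D' :=
  Subgroup.comap_inf D D' _

/-- `liftSub` is monotone. [claim: Mochizuki2012, status: disputed] -/
theorem liftSub_mono {D D' : Subgroup (G l)} (h : D ≤ D') : liftSub Γ l D ≤ liftSub Γ l D' :=
  Subgroup.comap_mono h

/-- `liftSub` is injective (`Γ × D` determines `D`). [claim: Mochizuki2012, status: disputed] -/
theorem liftSub_injective : Function.Injective (liftSub Γ l) := fun D D' h => by
  ext d
  have := SetLike.ext_iff.mp h ((1 : Γ), d)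
  simpa using this

/-- `{1} × D ≤ Γ × D`. [claim: Mochizuki2012, status: disputed] -/
theorem botSub_le_liftSub (D : Subgroup (G l)) : botSub Γ l D ≤ liftSub Γ l D := fun _ hx =>
  (mem_botSub.mp hx).2

/-- `botSub` is monotone. [claim: Mochizuki2012, status: disputed] -/
theorem botSub_mono {D D' : Subgroup (G l)} (h : D ≤ D') : botSub Γ l D ≤ botSub Γ l D' :=
  Subgroup.map_mono h

/-- `(Γ × D) ∩ ({1} × E) = {1} × (D ∩ E)`. [claim: Mochizuki2012, status: disputed] -/
theorem liftSub_inf_botSub (D E : Subgroup (G l)) : liftSub Γ l D ⊓ botSub Γ l E = botSub Γ l (D ⊓ E) := by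
  ext x
  simp only [Subgroup.mem_inf, mem_liftSub, mem_botSub]
  tauto

/-- `{1} × (D ⊔ E) = ({1} × D) ⊔ ({1} × E)`. [claim: Mochizuki2012, status: disputed] -/
theorem botSub_sup (D E : Subgroup (G l)) : botSub Γ l (D ⊔ E) = botSub Γ l D ⊔ botSub Γ l E :=
  Subgroup.map_sup D E _

/-- `{1} × ⨆ D_i = ⨆ {1} × D_i`. [claim: Mochizuki2012, status: disputed] -/
theorem botSub_iSup {ι : Sort*} (D : ι → Subgroup (G l)) : botSub Γ l (⨆ i, D i) = ⨆ i, botSub Γ l (D i) :=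
  Subgroup.map_iSup _ D

/-- `{1} × ⟨S⟩ = ⟨(1, S)⟩`. [claim: Mochizuki2012, status: disputed] -/
theorem botSub_closure (S : Set (G l)) :
    botSub Γ l (Subgroup.closure S) = Subgroup.closure ((MonoidHom.inr Γ (G l)) '' S) :=
  MonoidHom.map_closure _ S

/-- `(Γ × D) ⊔ ({1} × E) = Γ × (D ⊔ E)` (since `(γ, φ) = (γ, 1)·(1, φ)` and `1 ∈ D`).
[claim: Mochizuki2012, status: disputed] -/
theorem liftSub_sup_botSub (D E : Subgroup (G l)) : liftSub Γ l D ⊔ botSub Γ l E = liftSub Γ l (D ⊔ E) := by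
  refine le_antisymm (sup_le (liftSub_mono Γ l le_sup_left)
    ((botSub_le_liftSub Γ l E).trans (liftSub_mono Γ l le_sup_right))) fun x hx => ?_
  have e : x = ((x.1, (1 : G l)) : Γ × G l) * ((1 : Γ), x.2) := by ext <;> simp
  rw [e]
  refine Subgroup.mul_mem _ (Subgroup.mem_sup_left (by simp [mem_liftSub])) ?_
  -- `(1, x.2)` with `x.2 ∈ D ⊔ E` lies in `botSub (D ⊔ E) = botSub D ⊔ botSub E ≤ liftSub D ⊔ botSub E`
  have h2 : ((1 : Γ), x.2) ∈ botSub Γ l (D ⊔ E) := mem_botSub.mpr ⟨rfl, hx⟩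
  rw [botSub_sup] at h2
  exact sup_le_sup_right (botSub_le_liftSub Γ l D) _ h2

/-- Conjugation in `Γ × Φ` transports: `(γ, φ)·(Γ × D)·(γ, φ)⁻¹ = Γ × (φ D φ⁻¹)`.
[claim: Mochizuki2012, status: disputed] -/
theorem conj_smul_liftSub (x : Γ × G l) (D : Subgroup (G l)) :
    MulAut.conj x • liftSub Γ l D = liftSub Γ l (MulAut.conj x.2 • D) := by
  ext y
  rw [Subgroup.mem_pointwise_smul_iff_inv_smul_mem, mem_liftSub, mem_liftSub,
    Subgroup.mem_pointwise_smul_iff_inv_smul_mem]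
  rfl

/-- The normaliser transports: `N_{Γ × Φ}(Γ × D) = Γ × N_Φ(D)`. [claim: Mochizuki2012, status: disputed] -/
theorem normalizer_liftSub (D : Subgroup (G l)) :
    Subgroup.normalizer (liftSub Γ l D : Set (Γ × G l)) = liftSub Γ l (Subgroup.normalizer (D : Set (G l))) := by
  ext x
  rw [mem_liftSub, Subgroup.mem_set_normalizer_iff, Subgroup.mem_set_normalizer_iff]
  constructor
  · intro h d
    have := h ((1 : Γ), d)
    simpa [mem_liftSub] using this
  · intro h y
    have := h y.2
    simpa [mem_liftSub] using this

/-- Normality transports to `Γ × Φ_C̲`. [claim: Mochizuki2012, status: disputed] -/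
theorem normal_subgroupOf_liftSub {D L : Subgroup (G l)} (h : (D.subgroupOf L).Normal) :
    ((liftSub Γ l D).subgroupOf (liftSub Γ l L)).Normal := by
  refine ⟨fun x hx y => ?_⟩
  rw [Subgroup.mem_subgroupOf] at hx ⊢
  have := h.conj_mem ⟨x.1.2, x.2⟩ hx ⟨y.1.2, y.2⟩
  exact this

/-- Normality of `{1} × D` inside `Γ × L`. [claim: Mochizuki2012, status: disputed] -/
theorem normal_botSub_subgroupOf_liftSub {D L : Subgroup (G l)} (hDL : D ≤ L) (h : (D.subgroupOf L).Normal) :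
    ((botSub Γ l D).subgroupOf (liftSub Γ l L)).Normal := by
  refine ⟨fun x hx y => ?_⟩
  rw [Subgroup.mem_subgroupOf, mem_botSub] at hx ⊢
  obtain ⟨hx1, hx2⟩ := hx
  refine ⟨by simp [hx1], ?_⟩
  have := h.conj_mem ⟨x.1.2, hDL hx2⟩ (Subgroup.mem_subgroupOf.mpr hx2) ⟨y.1.2, y.2⟩
  exact Subgroup.mem_subgroupOf.mp this

/-- The quotient transports: `(Γ × L)/(Γ × D) ≅ L/D` — so cyclicity of the Galois groups is inherited.
[claim: Mochizuki2012, status: disputed] -/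
theorem isCyclic_quot_liftSub {D L : Subgroup (G l)}
    (h : ∀ [(D.subgroupOf L).Normal], IsCyclic (L ⧸ D.subgroupOf L)) :
    ∀ [((liftSub Γ l D).subgroupOf (liftSub Γ l L)).Normal],
      IsCyclic (liftSub Γ l L ⧸ (liftSub Γ l D).subgroupOf (liftSub Γ l L)) := by
  intro hN
  -- `D.subgroupOf L` is normal too: restrict along `L → Γ × L`, `d ↦ (1, d)`
  haveI : (D.subgroupOf L).Normal := by
    refine ⟨fun d hd e => ?_⟩
    have := hN.conj_mem ⟨((1 : Γ), d.1), d.2⟩ (Subgroup.mem_subgroupOf.mpr (Subgroup.mem_subgroupOf.mp hd))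
      ⟨((1 : Γ), e.1), e.2⟩
    exact Subgroup.mem_subgroupOf.mp this
  haveI := h
  -- the projection `Γ × L → L → L/D` is surjective with kernel `Γ × D`
  let σ : liftSub Γ l L →* L :=
    ((MonoidHom.snd Γ (G l)).restrict (liftSub Γ l L)).codRestrict L fun x => mem_liftSub.mp x.2
  let π : liftSub Γ l L →* L ⧸ D.subgroupOf L := (QuotientGroup.mk' (D.subgroupOf L)).comp σ
  have hπ : Function.Surjective π := by
    intro q
    induction q using QuotientGroup.induction_on with
    | H d => exact ⟨⟨((1 : Γ), d.1), by simp [d.2]⟩, rfl⟩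
  have hker : π.ker = (liftSub Γ l D).subgroupOf (liftSub Γ l L) := by
    ext x
    rw [MonoidHom.mem_ker, MonoidHom.comp_apply, QuotientGroup.mk'_apply, QuotientGroup.eq_one_iff,
      Subgroup.mem_subgroupOf, Subgroup.mem_subgroupOf]
    rfl
  have e := (QuotientGroup.quotientKerEquivOfSurjective π hπ).symm.trans
    (QuotientGroup.quotientMulEquivOfEq hker)
  exact isCyclic_of_surjective e e.surjective

/-- `1 ≠ 0`, `−1 ≠ 0`, `1 ≠ −1`, `2 ∉ {0, 1, −1}` in `ℤ/l` for `l ≥ 5`. [claim: Mochizuki2012, status: disputed] -/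
theorem cusp_facts_of_five_le (l : ℕ) (h5 : 5 ≤ l) :
    (1 : ZMod l) ≠ 0 ∧ (-1 : ZMod l) ≠ 0 ∧ (1 : ZMod l) ≠ -1 ∧
      ((2 : ZMod l) ≠ 0 ∧ (2 : ZMod l) ≠ 1 ∧ (2 : ZMod l) ≠ -1) := by
  have h1 : (1 : ZMod l) ≠ 0 := by exact_mod_cast natCast_ne_zero_of_lt l (a := 1) one_pos (by omega)
  have h2 : (2 : ZMod l) ≠ 0 := by exact_mod_cast natCast_ne_zero_of_lt l (a := 2) two_pos (by omega)
  have h3 : (3 : ZMod l) ≠ 0 := by exact_mod_cast natCast_ne_zero_of_lt l (a := 3) three_pos (by omega)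
  refine ⟨h1, neg_ne_zero.mpr h1, fun h => h2 ?_, h2, fun h => h1 ?_, fun h => h3 ?_⟩
  · linear_combination h
  · linear_combination h
  · linear_combination h

end Transport

/-! ### The cusp action on `Γ × Φ` (through `Φ ↠ D_l`) and its laws -/

section LiftLaws

variable (Γ : Type) [Group Γ] (l : ℕ)


/-- `act_decomp` for `pedOf`: `(γ,φ)·(Γ × D_i)·(γ,φ)⁻¹ = Γ × D_{φ·i}` on the nose. [claim: Mochizuki2012, status: disputed] -/
theorem lift_act_decomp (g : Γ × G l) (i : ZMod l) :
    ∃ t ∈ liftSub Γ l (PiXm l) ⊓ liftSub Γ l (PiCbarm l),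
      MulAut.conj (t * g) • liftSub Γ l (Dm l i) = liftSub Γ l (Dm l (actm l g.2 i)) :=
  ⟨1, Subgroup.one_mem _, by rw [one_mul, conj_smul_liftSub, conj_smul_Dm, actm_apply]⟩

/-- `eq_of_conj` for `pedOf`. [claim: Mochizuki2012, status: disputed] -/
theorem lift_eq_of_conj (h3 : 3 ≤ l) (i j : ZMod l) (t : Γ × G l)
    (ht : t ∈ liftSub Γ l (PiXm l) ⊓ liftSub Γ l (PiCbarm l))
    (h : MulAut.conj t • liftSub Γ l (Dm l i) = liftSub Γ l (Dm l j)) : i = j := by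
  rw [← liftSub_inf, mem_liftSub] at ht
  rw [conj_smul_liftSub] at h
  exact eq_of_conj_aux l h3 i j t.2 ht (liftSub_injective Γ l h)

/-- `free` for `pedOf`. [claim: Mochizuki2012, status: disputed] -/
theorem lift_free (g : Γ × G l) (hg : g ∈ liftSub Γ l (PiXm l)) (i : ZMod l) (h : actm l g.2 i = i) :
    g ∈ liftSub Γ l (PiXm l) ⊓ liftSub Γ l (PiCbarm l) := by
  rw [← liftSub_inf, mem_liftSub]
  exact free_aux l g.2 hg i h

/-- `transitive` for `pedOf`. [claim: Mochizuki2012, status: disputed] -/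
theorem lift_transitive (i j : ZMod l) : ∃ g ∈ liftSub Γ l (PiXm l), actm l g.2 i = j := by
  obtain ⟨g, hg, h⟩ := transitive_aux l i j
  exact ⟨((1 : Γ), g), hg, h⟩

/-- `exists_generator` for `pedOf`. [claim: Mochizuki2012, status: disputed] -/
theorem lift_generator [NeZero l] : ∃ g ∈ liftSub Γ l (PiXm l), ∀ h ∈ liftSub Γ l (PiXm l),
    ∃ n : ℤ, actm l h.2 = actm l g.2 ^ n := by
  obtain ⟨g, hg, hgen⟩ := generator_aux l
  exact ⟨((1 : Γ), g), hg, fun h hh => hgen h.2 hh⟩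

/-- `conj_mul_mem_PiXbar` for `pedOf`. [claim: Mochizuki2012, status: disputed] -/
theorem lift_conj (c : Γ × G l) (hc : c ∈ liftSub Γ l (PiCbarm l)) (hcX : c ∉ liftSub Γ l (PiXm l))
    (g : Γ × G l) (hg : g ∈ liftSub Γ l (PiXm l)) :
    c * g * c⁻¹ * g ∈ liftSub Γ l (PiXm l) ⊓ liftSub Γ l (PiCbarm l) := by
  rw [← liftSub_inf, mem_liftSub]
  exact conj_aux l c.2 hc hcX g.2 hg

/-- `act_ε0` for `pedOf`. [claim: Mochizuki2012, status: disputed] -/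
theorem lift_act0 (c : Γ × G l) (hc : c ∈ liftSub Γ l (PiCbarm l)) : actm l c.2 0 = 0 := act0_aux l c.2 hc

/-- `act_ε1` for `pedOf`. [claim: Mochizuki2012, status: disputed] -/
theorem lift_act1 (c : Γ × G l) (hc : c ∈ liftSub Γ l (PiCbarm l)) (hcX : c ∉ liftSub Γ l (PiXm l)) :
    actm l c.2 1 = -1 := act1_aux l c.2 hc hcX

/-- `act_twoε` for `pedOf`. [claim: Mochizuki2012, status: disputed] -/
theorem lift_act2 (g : Γ × G l) (hg : g ∈ liftSub Γ l (PiXm l)) (h : actm l g.2 0 = 1) :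
    actm l (g * g).2 0 = 2 ∨ actm l (g⁻¹ * g⁻¹).2 0 = 2 := act2_aux l g.2 hg h

end LiftLaws

/-! ### The extension `Γ × Φ ↠ Γ` and the datum over `Γ` -/

section Model

variable (Γ : Type) [Group Γ] [TopologicalSpace Γ] [IsTopologicalGroup Γ] [CompactSpace Γ]
  [TotallyDisconnectedSpace Γ] (l : ℕ) [NeZero l]

/-- `Π_C := Γ × Φ ↠ Γ = G_k` (first projection) as a `FundamentalExtension`; `Φ = N ⋊ D_l` carries the
discrete topology (local instances, none registered). ([IUTchI] Def 3.1(b) p.61) [claim: Mochizuki2012, status: disputed] -/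
noncomputable def extOf : FundamentalExtension.{0} :=
  letI : TopologicalSpace (G l) := ⊥
  haveI : DiscreteTopology (G l) := ⟨rfl⟩
  haveI : IsTopologicalGroup (G l) := {}
  haveI : Finite (G l) := finite_G l
  { arith := ProfiniteGrp.of (Γ × G l)
    gal := ProfiniteGrp.of Γ
    aug := ContinuousMonoidHom.fst Γ (G l)
    aug_surjective := Prod.fst_surjective }

omit [IsTopologicalGroup Γ] [CompactSpace Γ] [TotallyDisconnectedSpace Γ] [NeZero l] in
/-- `Γ × D` is open in `Γ × Φ` (discrete second factor). [claim: Mochizuki2012, status: disputed] -/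
theorem isOpen_liftSub (D : Subgroup (G l)) :
    letI : TopologicalSpace (G l) := ⊥; IsOpen (liftSub Γ l D : Set (Γ × G l)) := by
  letI : TopologicalSpace (G l) := ⊥
  haveI : DiscreteTopology (G l) := ⟨rfl⟩
  exact (isOpen_discrete (D : Set (G l))).preimage continuous_snd

omit [IsTopologicalGroup Γ] [CompactSpace Γ] [TotallyDisconnectedSpace Γ] [NeZero l] in
/-- `Γ × D` is closed in `Γ × Φ`. [claim: Mochizuki2012, status: disputed] -/
theorem isClosed_liftSub (D : Subgroup (G l)) :
    letI : TopologicalSpace (G l) := ⊥; IsClosed (liftSub Γ l D : Set (Γ × G l)) := by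
  letI : TopologicalSpace (G l) := ⊥
  haveI : DiscreteTopology (G l) := ⟨rfl⟩
  exact (isClosed_discrete (D : Set (G l))).preimage continuous_snd

/-- `Γ × D ↠ Γ` (`(γ, 1) ∈ Γ × D`). [claim: Mochizuki2012, status: disputed] -/
theorem fst_liftSub_surjective (D : Subgroup (G l)) :
    Function.Surjective ((extOf Γ l).aug.toMonoidHom.comp (liftSub Γ l D).subtype) := fun g =>
  ⟨⟨(g, 1), by simp [mem_liftSub]⟩, rfl⟩

/-- `Δ_C = Ker(Γ × Φ ↠ Γ) = {1} × Φ`. [claim: Mochizuki2012, status: disputed] -/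
theorem geom_extOf : (extOf Γ l).geom = botSub Γ l ⊤ := by
  ext x
  constructor
  · intro h
    have h1 : x.1 = 1 := (FundamentalExtension.mem_geom _).mp h
    exact ⟨x.2, Subgroup.mem_top _, Prod.ext h1.symm rfl⟩
  · rintro ⟨d, -, rfl⟩
    exact (FundamentalExtension.mem_geom _).mpr rfl

/-- **The §1 model datum over `Γ`**: `Π_C = Γ × (N ⋊ D_l) ↠ Γ`, `Π_X = Γ × Φ_X`, `Π_C̲ = Γ × Φ_C̲`, cusps `ℤ/l`
with `D_i = Γ × ⟨ĉ_i⟩` (rational cusps: `D_i ↠ Γ = G_k`), `ε⁰, ε′, ε″, 2ε := 0, 1, −1, 2`.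
([IUTchI] §1 p.37) [claim: Mochizuki2012, status: disputed] -/
noncomputable def pedOf (h5 : 5 ≤ l) (h6 : Nat.Coprime l 6) : PuncturedEllipticData.{0} where
  l := l
  five_le := h5
  coprime_six := h6
  E := extOf Γ l
  PiX := liftSub Γ l (PiXm l)
  PiCbar := liftSub Γ l (PiCbarm l)
  isOpen_piX := isOpen_liftSub Γ l (PiXm l)
  isOpen_piCbar := isOpen_liftSub Γ l (PiCbarm l)
  index_piX := (liftSub_index Γ l (PiXm l)).trans (index_PiXm l)
  aug_piX := fst_liftSub_surjective Γ l (PiXm l)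
  aug_piCbar := fst_liftSub_surjective Γ l (PiCbarm l)
  star := by
    intro g hg x hx
    -- `g x g⁻¹ x⁻¹ = ⁅(1, g.2), x⁆` since `x.1 = 1`
    have hx1 : x.1 = 1 := (FundamentalExtension.mem_geom _).mp hx.2
    let y : (extOf Γ l).arith := ((1 : Γ), g.2)
    have hy : y ∈ liftSub Γ l (PiXm l) ⊓ (extOf Γ l).geom :=
      ⟨show g.2 ∈ PiXm l from hg, (FundamentalExtension.mem_geom _).mpr rfl⟩
    have e : g * x * g⁻¹ * x⁻¹ = y * x * y⁻¹ * x⁻¹ := by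
      refine Prod.ext ?_ rfl
      show g.1 * x.1 * g.1⁻¹ * x.1⁻¹ = 1 * x.1 * 1⁻¹ * x.1⁻¹
      simp [hx1]
    have hc := Subgroup.commutator_mem_commutator hy hx
    rw [commutatorElement_def] at hc
    rw [e]
    exact Subgroup.le_topologicalClosure _ (Subgroup.mem_sup_left hc)
  Cusp := ZMod l
  decomp := fun i => liftSub Γ l (Dm l i)
  decomp_le := fun i x hx => by
    have h : x.2 ∈ Nhat l := Dm_le_Nhat l i hx
    rw [← PiXm_inf_PiCbarm] at h
    exact h
  ε0 := 0
  ε1 := 1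
  ε2 := -1
  twoε := 2
  ε1_ne_ε0 := (cusp_facts_of_five_le l h5).1
  ε2_ne_ε0 := (cusp_facts_of_five_le l h5).2.1
  ε1_ne_ε2 := (cusp_facts_of_five_le l h5).2.2.1
  twoε_ne := (cusp_facts_of_five_le l h5).2.2.2
  aug_decomp_twoε := fst_liftSub_surjective Γ l (Dm l 2)

/-- **The cusp Galois action of `pedOf Γ l`**: through `Γ × Φ ↠ Φ ↠ D_l ↷ ℤ/l`. ([IUTchI] §1 p.37)
[claim: Mochizuki2012, status: disputed] -/
noncomputable def liftCuspGalois (h5 : 5 ≤ l) (h6 : Nat.Coprime l 6) : (pedOf Γ l h5 h6).CuspGalois :=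
  letI : TopologicalSpace (G l) := ⊥
  haveI : DiscreteTopology (G l) := ⟨rfl⟩
  { act := (actm l).comp (MonoidHom.snd Γ (G l))
    act_decomp := lift_act_decomp Γ l
    eq_of_conj := lift_eq_of_conj Γ l (by omega)
    isClosed_decomp := fun x => isClosed_liftSub Γ l (Dm l x)
    free := lift_free Γ l
    transitive := lift_transitive Γ l
    exists_generator := lift_generator Γ l
    conj_mul_mem_PiXbar := lift_conj Γ l
    act_ε0 := lift_act0 Γ l
    act_ε1 := lift_act1 Γ l
    act_twoε := lift_act2 Γ l }

end Model

end ArrowModel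

end PuncturedEllipticData

end Literature.IUT.HodgeTheaters
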